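import Mathlib

/-!
# Finite bond percolation: configurations, product Bernoulli weight, events, probabilities

Bernoulli bond percolation on a finite edge type `E`: every edge `e` is open independently with
probability `p e ∈ [0, 1]`.

* A configuration is `ω : E → Bool` (`Config E`), `ω e = true` meaning that `e` is open.
  Configurations carry the product order (`false < true` coordinatewise), so an *increasing*
  event is an `IsUpperSet` and a *decreasing* event an `IsLowerSet`.
* The law is the product Bernoulli weight `weight p ω = ∏ e, (if ω e then p e else 1 - p e)`.
* The probability of an event `A : Set (Config E)` is the finite sum
  `prob p A = ∑ ω, A.indicator (weight p) ω`, and `expect p f = ∑ ω, weight p ω * f ω`.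

Main results: `sum_weight` (total mass `1`), `weight_inf_mul_weight_sup` (log-modularity, the
input of the FKG / Harris inequality), the elementary probability calculus (`prob_nonneg`,
`prob_le_one`, `prob_mono`, `prob_compl`, `prob_union_add_inter`, …), the law of total
probability over the fibres of a map into a finite type (`prob_eq_sum_fiber`, `sum_prob_fiber`,
`prob_preimage_coe`).

Conditioning on one edge (`prob_split`: `P_p(A) = p_e · P_{p[e:=1]}(A) + (1 - p_e) · P_{p[e:=0]}(A)`)
is in `Summits.Ventures.PercRepro.Conditioning`; the graph structure (open clusters, connection
and partition events of marked vertices) is in `Summits.Ventures.PercRepro.Graph`.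
-/

namespace PercRepro

open Finset

/-- A bond-percolation configuration on the edge type `E`: `ω e = true` iff the edge `e` is open. -/
abbrev Config (E : Type*) := E → Bool

variable {E : Type*}

/-! ### Edge probabilities -/

/-- `IsProb p`: `p` is a vector of edge probabilities, i.e. `0 ≤ p e ≤ 1` for every edge `e`. -/
def IsProb (p : E → ℝ) : Prop := ∀ e, 0 ≤ p e ∧ p e ≤ 1

/-- Edge probabilities are nonnegative. -/
theorem IsProb.nonneg {p : E → ℝ} (hp : IsProb p) (e : E) : 0 ≤ p e := (hp e).1

/-- Edge probabilities are at most `1`. -/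
theorem IsProb.le_one {p : E → ℝ} (hp : IsProb p) (e : E) : p e ≤ 1 := (hp e).2

/-- The closing probability `1 - p e` is nonnegative. -/
theorem IsProb.one_sub_nonneg {p : E → ℝ} (hp : IsProb p) (e : E) : 0 ≤ 1 - p e := by
  linarith [hp.le_one e]

/-- The closing probability `1 - p e` is at most `1`. -/
theorem IsProb.one_sub_le_one {p : E → ℝ} (hp : IsProb p) (e : E) : 1 - p e ≤ 1 := by
  linarith [hp.nonneg e]

/-- The constant vector `q` is a probability vector when `0 ≤ q ≤ 1` (uniform percolation). -/
theorem isProb_const {q : ℝ} (h0 : 0 ≤ q) (h1 : q ≤ 1) : IsProb (fun _ : E => q) :=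
  fun _ => ⟨h0, h1⟩

/-- Changing one edge probability to a value in `[0, 1]` preserves `IsProb`. -/
theorem IsProb.update [DecidableEq E] {p : E → ℝ} (hp : IsProb p) (e : E) {x : ℝ}
    (hx : 0 ≤ x ∧ x ≤ 1) : IsProb (Function.update p e x) := by
  intro e'
  by_cases h : e' = e
  · subst h
    simpa using hx
  · rw [Function.update_of_ne h]
    exact hp e'

/-! ### The product Bernoulli weight -/

section Weight

variable [Fintype E]

/-- Product Bernoulli weight of the configuration `ω`: the product over all edges of `p e` if
the edge is open in `ω` and of `1 - p e` if it is closed. -/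
def weight (p : E → ℝ) (ω : Config E) : ℝ := ∏ e, if ω e then p e else 1 - p e

/-- The weight of a configuration is nonnegative. -/
theorem weight_nonneg {p : E → ℝ} (hp : IsProb p) (ω : Config E) : 0 ≤ weight p ω :=
  Finset.prod_nonneg fun e _ => by
    split_ifs
    · exact hp.nonneg e
    · exact hp.one_sub_nonneg e

/-- The weight of a configuration is at most `1`. -/
theorem weight_le_one {p : E → ℝ} (hp : IsProb p) (ω : Config E) : weight p ω ≤ 1 :=
  Finset.prod_le_one
    (fun e _ => by
      split_ifs
      · exact hp.nonneg e
      · exact hp.one_sub_nonneg e)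
    (fun e _ => by
      split_ifs
      · exact hp.le_one e
      · exact hp.one_sub_le_one e)

/-- The set of open edges of a configuration. -/
def openEdges (ω : Config E) : Finset E := univ.filter fun e => ω e = true

/-- Membership in the set of open edges. -/
@[simp] theorem mem_openEdges {ω : Config E} {e : E} : e ∈ openEdges ω ↔ ω e = true := by
  simp [openEdges]

/-- The weight as a product over the open edges times a product over the closed edges. -/
theorem weight_eq_prod_openEdges [DecidableEq E] (p : E → ℝ) (ω : Config E) :
    weight p ω = (∏ e ∈ openEdges ω, p e) * ∏ e ∈ (openEdges ω)ᶜ, (1 - p e) := by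
  have h : (openEdges ω)ᶜ = univ.filter fun e => ¬ ω e = true := by
    ext e
    simp
  rw [h]
  unfold weight openEdges
  exact Finset.prod_ite _ _

/-- Uniform percolation with parameter `q`: the weight of `ω` is `q ^ #open · (1 - q) ^ #closed`. -/
theorem weight_const [DecidableEq E] (q : ℝ) (ω : Config E) :
    weight (fun _ => q) ω =
      q ^ (openEdges ω).card * (1 - q) ^ (Fintype.card E - (openEdges ω).card) := by
  rw [weight_eq_prod_openEdges]
  simp only [Finset.prod_const, Finset.card_compl]

/-- One-edge factor of the weight: `(if x then q else 1 - q) (if y then q else 1 - q)` is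
invariant under replacing `(x, y)` by `(x ⊓ y, x ⊔ y)`. -/
theorem bool_factor_mul (q : ℝ) (x y : Bool) :
    (if x then q else 1 - q) * (if y then q else 1 - q) =
      (if x ⊓ y then q else 1 - q) * (if x ⊔ y then q else 1 - q) := by
  cases x <;> cases y <;> simp [mul_comm]

/-- **Log-modularity** of the product weight on the lattice `E → Bool`:
`w(ω) w(ω') = w(ω ⊓ ω') w(ω ⊔ ω')`.  This is the hypothesis of Mathlib's four functions theorem
`fkg`, hence the source of the Harris / FKG inequality. -/
theorem weight_inf_mul_weight_sup (p : E → ℝ) (ω ω' : Config E) :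
    weight p ω * weight p ω' = weight p (ω ⊓ ω') * weight p (ω ⊔ ω') := by
  unfold weight
  rw [← Finset.prod_mul_distrib, ← Finset.prod_mul_distrib]
  refine Finset.prod_congr rfl fun e _ => ?_
  simp only [Pi.inf_apply, Pi.sup_apply]
  exact bool_factor_mul (p e) (ω e) (ω' e)

variable [DecidableEq E]

/-- **Total mass**: the product Bernoulli weights of all configurations sum to `1`. -/
theorem sum_weight (p : E → ℝ) : ∑ ω : Config E, weight p ω = 1 := by
  have h : ∑ ω : Config E, weight p ω = ∏ e, ∑ b : Bool, (if b then p e else 1 - p e) :=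
    (Fintype.prod_sum (fun e (b : Bool) => if b then p e else 1 - p e)).symm
  rw [h]
  simp

end Weight

/-! ### Expectation and probability -/

section Prob

variable [Fintype E] [DecidableEq E]

/-- Expectation `E_p[f] = ∑ ω, weight p ω * f ω` of a real function of the configuration. -/
def expect (p : E → ℝ) (f : Config E → ℝ) : ℝ := ∑ ω, weight p ω * f ω

/-- Probability `P_p(A) = ∑ ω ∈ A, weight p ω` of the event `A` under the product Bernoulli law
with edge probabilities `p` (written with `Set.indicator`, so no decidability instance for `A`
enters the statement). -/
noncomputable def prob (p : E → ℝ) (A : Set (Config E)) : ℝ := ∑ ω, A.indicator (weight p) ω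

/-- The probability as a sum over the configurations of the event. -/
theorem prob_eq_sum_filter (p : E → ℝ) (A : Set (Config E)) [DecidablePred (· ∈ A)] :
    prob p A = ∑ ω ∈ univ.filter (· ∈ A), weight p ω := by
  unfold prob
  rw [Finset.sum_filter]
  refine Finset.sum_congr rfl fun ω _ => ?_
  by_cases h : ω ∈ A <;> simp [Set.indicator, h]

/-- The probability of `A` is the expectation of its indicator. -/
theorem prob_eq_expect_indicator (p : E → ℝ) (A : Set (Config E)) :
    prob p A = expect p (A.indicator 1) := by
  unfold prob expect
  refine Finset.sum_congr rfl fun ω _ => ?_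
  by_cases h : ω ∈ A <;> simp [Set.indicator, h]

/-- The expectation of an indicator is a probability. -/
theorem expect_indicator_one (p : E → ℝ) (A : Set (Config E)) :
    expect p (A.indicator 1) = prob p A :=
  (prob_eq_expect_indicator p A).symm

/-- Probabilities are nonnegative. -/
theorem prob_nonneg {p : E → ℝ} (hp : IsProb p) (A : Set (Config E)) : 0 ≤ prob p A :=
  Finset.sum_nonneg fun ω _ => Set.indicator_nonneg (fun ω _ => weight_nonneg hp ω) ω

/-- The sure event has probability `1`. -/
theorem prob_univ (p : E → ℝ) : prob p Set.univ = 1 := by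
  simp [prob, sum_weight]

/-- The empty event has probability `0`. -/
theorem prob_empty (p : E → ℝ) : prob p ∅ = 0 := by
  simp [prob]

/-- Monotonicity of probability in the event. -/
theorem prob_mono {p : E → ℝ} (hp : IsProb p) {A B : Set (Config E)} (h : A ⊆ B) :
    prob p A ≤ prob p B :=
  Finset.sum_le_sum fun ω _ =>
    Set.indicator_le_indicator_of_subset h (fun ω => weight_nonneg hp ω) ω

/-- Probabilities are at most `1`. -/
theorem prob_le_one {p : E → ℝ} (hp : IsProb p) (A : Set (Config E)) : prob p A ≤ 1 := by
  rw [← prob_univ p]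
  exact prob_mono hp (Set.subset_univ A)

/-- Complement rule `P(Aᶜ) = 1 - P(A)`. -/
theorem prob_compl (p : E → ℝ) (A : Set (Config E)) : prob p Aᶜ = 1 - prob p A := by
  rw [← prob_univ p, prob, prob, prob, ← Finset.sum_sub_distrib]
  refine Finset.sum_congr rfl fun ω _ => ?_
  by_cases h : ω ∈ A <;> simp [Set.indicator, h]

/-- Inclusion–exclusion for two events: `P(A ∪ B) + P(A ∩ B) = P(A) + P(B)`. -/
theorem prob_union_add_inter (p : E → ℝ) (A B : Set (Config E)) :
    prob p (A ∪ B) + prob p (A ∩ B) = prob p A + prob p B := by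
  unfold prob
  rw [← Finset.sum_add_distrib, ← Finset.sum_add_distrib]
  refine Finset.sum_congr rfl fun ω _ => ?_
  by_cases hA : ω ∈ A <;> by_cases hB : ω ∈ B <;> simp [Set.indicator, hA, hB]

/-- The union bound for two events. -/
theorem prob_union_le {p : E → ℝ} (hp : IsProb p) (A B : Set (Config E)) :
    prob p (A ∪ B) ≤ prob p A + prob p B := by
  have h1 := prob_union_add_inter p A B
  have h2 := prob_nonneg hp (A ∩ B)
  linarith

/-- Additivity on disjoint events. -/
theorem prob_union_of_disjoint (p : E → ℝ) {A B : Set (Config E)} (h : Disjoint A B) :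
    prob p (A ∪ B) = prob p A + prob p B := by
  have h1 := prob_union_add_inter p A B
  rw [Set.disjoint_iff_inter_eq_empty.1 h, prob_empty] at h1
  linarith

/-- Splitting an event along a second one: `P(A ∩ B) + P(A ∩ Bᶜ) = P(A)`. -/
theorem prob_inter_add_prob_inter_compl (p : E → ℝ) (A B : Set (Config E)) :
    prob p (A ∩ B) + prob p (A ∩ Bᶜ) = prob p A := by
  unfold prob
  rw [← Finset.sum_add_distrib]
  refine Finset.sum_congr rfl fun ω _ => ?_
  by_cases hA : ω ∈ A <;> by_cases hB : ω ∈ B <;> simp [Set.indicator, hA, hB]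

/-- `P(A ∩ B) ≤ P(A)`. -/
theorem prob_inter_le_left {p : E → ℝ} (hp : IsProb p) (A B : Set (Config E)) :
    prob p (A ∩ B) ≤ prob p A :=
  prob_mono hp Set.inter_subset_left

/-- `P(A ∩ B) ≤ P(B)`. -/
theorem prob_inter_le_right {p : E → ℝ} (hp : IsProb p) (A B : Set (Config E)) :
    prob p (A ∩ B) ≤ prob p B :=
  prob_mono hp Set.inter_subset_right

/-- `P(A \ B) = P(A) - P(A ∩ B)`. -/
theorem prob_diff (p : E → ℝ) (A B : Set (Config E)) :
    prob p (A \ B) = prob p A - prob p (A ∩ B) := by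
  have h := prob_inter_add_prob_inter_compl p A B
  rw [Set.sdiff_eq]
  linarith

/-- **Law of total probability** over the fibres of a map `f` into a finite type:
`P(A) = ∑ b, P(A ∩ {f = b})`. -/
theorem prob_eq_sum_fiber {β : Type*} [Fintype β] [DecidableEq β] (p : E → ℝ)
    (f : Config E → β) (A : Set (Config E)) :
    prob p A = ∑ b, prob p (A ∩ f ⁻¹' {b}) := by
  unfold prob
  rw [Finset.sum_comm]
  refine Finset.sum_congr rfl fun ω _ => ?_
  have key : ∀ b, (A ∩ f ⁻¹' {b}).indicator (weight p) ω =
      if f ω = b then A.indicator (weight p) ω else 0 := by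
    intro b
    by_cases hA : ω ∈ A <;> by_cases hb : f ω = b <;> simp [Set.indicator, hA, hb]
  simp [key]

/-- The fibre probabilities of a map into a finite type sum to `1`. -/
theorem sum_prob_fiber {β : Type*} [Fintype β] [DecidableEq β] (p : E → ℝ)
    (f : Config E → β) : ∑ b, prob p (f ⁻¹' {b}) = 1 := by
  have h := prob_eq_sum_fiber p f Set.univ
  simpa [prob_univ] using h.symm

/-- The probability that `f` lands in a finite set `T` is the sum of the fibre probabilities
over `T`. -/
theorem prob_preimage_coe {β : Type*} [Fintype β] [DecidableEq β] (p : E → ℝ)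
    (f : Config E → β) (T : Finset β) :
    prob p (f ⁻¹' (T : Set β)) = ∑ b ∈ T, prob p (f ⁻¹' {b}) := by
  rw [prob_eq_sum_fiber p f, ← Fintype.sum_ite_mem T]
  refine Finset.sum_congr rfl fun b _ => ?_
  by_cases hb : b ∈ T
  · rw [if_pos hb]
    congr 1
    ext ω
    simp only [Set.mem_inter_iff, Set.mem_preimage, Finset.mem_coe, Set.mem_singleton_iff]
    exact ⟨fun h => h.2, fun h => ⟨by rw [h]; exact hb, h⟩⟩
  · rw [if_neg hb]
    have h0 : f ⁻¹' (T : Set β) ∩ f ⁻¹' {b} = ∅ := by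
      ext ω
      simp only [Set.mem_inter_iff, Set.mem_preimage, Finset.mem_coe, Set.mem_singleton_iff,
        Set.mem_empty_iff_false, iff_false, not_and]
      exact fun h1 h2 => hb (by rw [← h2]; exact h1)
    rw [h0, prob_empty]

/-! ### Expectation calculus -/

/-- The expectation of a constant. -/
theorem expect_const (p : E → ℝ) (c : ℝ) : expect p (fun _ => c) = c := by
  show ∑ ω, weight p ω * c = c
  rw [← Finset.sum_mul, sum_weight, one_mul]

/-- Linearity: `E[f + g] = E[f] + E[g]`. -/
theorem expect_add (p : E → ℝ) (f g : Config E → ℝ) :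
    expect p (f + g) = expect p f + expect p g := by
  unfold expect
  rw [← Finset.sum_add_distrib]
  refine Finset.sum_congr rfl fun ω _ => ?_
  simp [mul_add]

/-- Linearity: `E[f - g] = E[f] - E[g]`. -/
theorem expect_sub (p : E → ℝ) (f g : Config E → ℝ) :
    expect p (f - g) = expect p f - expect p g := by
  unfold expect
  rw [← Finset.sum_sub_distrib]
  refine Finset.sum_congr rfl fun ω _ => ?_
  simp [mul_sub]

/-- Linearity: `E[c · f] = c · E[f]`. -/
theorem expect_const_mul (p : E → ℝ) (c : ℝ) (f : Config E → ℝ) :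
    expect p (fun ω => c * f ω) = c * expect p f := by
  show ∑ ω, weight p ω * (c * f ω) = c * ∑ ω, weight p ω * f ω
  rw [Finset.mul_sum]
  refine Finset.sum_congr rfl fun ω _ => ?_
  ring

/-- Expectations of nonnegative functions are nonnegative. -/
theorem expect_nonneg {p : E → ℝ} (hp : IsProb p) {f : Config E → ℝ} (hf : ∀ ω, 0 ≤ f ω) :
    0 ≤ expect p f :=
  Finset.sum_nonneg fun ω _ => mul_nonneg (weight_nonneg hp ω) (hf ω)

/-- Monotonicity of the expectation in the function. -/
theorem expect_mono {p : E → ℝ} (hp : IsProb p) {f g : Config E → ℝ} (h : ∀ ω, f ω ≤ g ω) :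
    expect p f ≤ expect p g :=
  Finset.sum_le_sum fun ω _ => mul_le_mul_of_nonneg_left (h ω) (weight_nonneg hp ω)

end Prob

/-! ### Increasing and decreasing events -/

/-- The product order on configurations, spelled out: `ω ≤ ω'` iff every edge open in `ω` is
open in `ω'`. -/
theorem Config.le_iff {ω ω' : Config E} : ω ≤ ω' ↔ ∀ e, ω e = true → ω' e = true := by
  simp only [Pi.le_def, Bool.le_iff_imp]

/-- An increasing event is an upper set: opening more edges keeps it true. -/
theorem isUpperSet_iff {A : Set (Config E)} :
    IsUpperSet A ↔ ∀ ⦃ω ω' : Config E⦄, ω ≤ ω' → ω ∈ A → ω' ∈ A :=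
  Iff.rfl

/-- A decreasing event is a lower set: closing edges keeps it true. -/
theorem isLowerSet_iff {A : Set (Config E)} :
    IsLowerSet A ↔ ∀ ⦃ω ω' : Config E⦄, ω' ≤ ω → ω ∈ A → ω' ∈ A :=
  Iff.rfl

/-- Closing one edge gives a smaller configuration. -/
theorem update_false_le [DecidableEq E] (ω : Config E) (e : E) :
    Function.update ω e false ≤ ω := by
  intro e'
  by_cases h : e' = e
  · subst h
    simp
  · simp [Function.update_of_ne h]

/-- Opening one edge gives a larger configuration. -/
theorem le_update_true [DecidableEq E] (ω : Config E) (e : E) :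
    ω ≤ Function.update ω e true := by
  intro e'
  by_cases h : e' = e
  · subst h
    simp
  · simp [Function.update_of_ne h]

end PercRepro
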